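import Summits.CriticalPhenomena.SAWScalingLimit.Theorems.SAWDevelopingMapHexConjectureArchTailSummed
import HarnessLib

/-!
# Crux `HexConjecture` (stmt-CriticalPhenomena-0808), line `root-locality-replaces-loewner`:
half-plane arch tightness implies WINDOW-AVERAGED arch locality

Landing target:
`Summits/CriticalPhenomena/SAWScalingLimit/Theorems/SAWDevelopingMapHexConjectureWindowLocalityOfArchTightness.lean`
(`--supports stmt-CriticalPhenomena-0808`; lead continuation prover-line-stmt-CriticalPhenomena-0808-c5-0).

The line's lever used to be the registered open stub `stub_halfPlaneArchTightness` (HPAT, "RSW for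
the critical self-avoiding walk"): for every `ε > 0` ONE `K` such that for ALL spans `n ≥ 1`, every
finite `Λ` strictly above the horizontal line through a boundary mid-edge `s`, every boundary
mid-edge `t ≠ s` on that line with `|mid s - mid t| ≤ n`, and `B` the upper half-box of radius
`2Kn` around `mid s`, the `x_c`-mass of the arches `s → t` of `Λ` reaching distance `≥ Kn` from
`mid s` is at most `ε · Z_B(s, t)` — a RELATIVE bound, POINTWISE in the endpoint `t`.  The c5
reshape of the line consumes only the WEAKER *window-averaged arch locality* (WAL): for the vertical
floor mid-edge `s_x = {(x - e₁, 1), (x, 0)}` of a cell `x`, the floor mid-edges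
`t_d = {(x + d e₀ - e₁, 1), (x + d e₀, 0)}` at the offsets `d` of the lattice window
`S = {d : θ₁ R ≤ d ≤ θ₀ R}`, every finite `Λ` in the rows `≥ x₁` and `B` the part of the rows `≥ x₁`
within distance `R` of `mid s_x`,
`Σ_{d ∈ S} FarMass^R_Λ(s_x → t_d) ≤ η · Σ_{d ∈ S} Z_B(s_x → t_d)`
(both sides summed over the window; `θ₁ < θ₀ ≤ θb(η)`, `R ≥ R₀`).

This file records that the old lever implies the new one, TERMWISE
(`windowArchLocality_of_halfPlaneArchTightness`, registered as
`stub_windowArchLocality_of_archTightness`): for `d ∈ S` put `n := d` (a positive integer); HPAT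
with `ε := η` gives `K`; with `θb := 1/(2K)` one has `2Kn ≤ 2Kθ₀R ≤ R`, so
`FarMass^R_Λ(s_x → t_d) ≤ FarMass^{Kn}_Λ(s_x → t_d)` (the far indicator is antitone in the
threshold, `farArchMass_anti`) `≤ η · Z_{B'}(s_x → t_d)` for the half-box
`B' = {v ∈ B : |c_v - mid s_x| ≤ 2Kn}` of radius `2Kn` (HPAT; the floor mid-edges `s_x`, `t_d` are
boundary mid-edges of `Λ` as soon as their inner endpoints lie in `Λ`, and otherwise there is no
walk at all) `≤ η · Z_B(s_x → t_d)` (exact restriction `archMass_mono`, `B' ⊆ B`).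
Sources: LawlerSchrammWerner2004SAW §3.4 ("SAW satisfies restriction"); the geometry of floor
mid-edges is that of the sibling files `…ShortChordLocalityHelpers.lean`,
`…RestrictionCocycleHelpersLattice.lean`, `…HexConjectureArchTailSummed.lean`.
-/

noncomputable section

open scoped BigOperators Classical
open Literature.Probability.LatticeModels (HexVertex hexGraph hexCenter Site)
open Literature.Probability.RandomPlanarGeometry
open Literature.Probability.RandomPlanarGeometry.SAW
open Summit.CriticalPhenomena.SAWScalingLimit.Theorems.ObservableToSLE.FloorRatio

namespace Summit.CriticalPhenomena.SAWScalingLimit.Theorems.HexConjecture.RootLocality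

/-! ### The far mass is antitone in the threshold -/

/-- **The far arch mass is antitone in the threshold**: for `T ≤ R`, a walk with a vertex at
distance `≥ R` from `mid s` has a vertex at distance `≥ T`, so `FarMass^R_Λ(s → t) ≤ FarMass^T_Λ(s → t)`.
[folklore] -/
theorem farArchMass_anti (Λ : Finset HexVertex) (s t : Sym2 HexVertex) {T R : ℝ} (h : T ≤ R) :
    (∑ γ : HexMidEdgeSAW Λ s t,
        if ∃ v ∈ γ.verts, R ≤ dist (hexCenter v) (hexMidpoint s)
        then hexCriticalFugacity ^ γ.length else 0) ≤
      ∑ γ : HexMidEdgeSAW Λ s t,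
        if ∃ v ∈ γ.verts, T ≤ dist (hexCenter v) (hexMidpoint s)
        then hexCriticalFugacity ^ γ.length else 0 := by
  refine Finset.sum_le_sum fun γ _ => ?_
  split_ifs with hR hT
  · exact le_rfl
  · exact absurd (hR.imp fun v hv => ⟨hv.1, h.trans hv.2⟩) hT
  · exact pow_nonneg hexCriticalFugacity_pos_lt_one.1.le _
  · exact le_rfl

/-! ### Floor mid-edges with inner endpoint in the domain are boundary mid-edges -/

/-- For `Λ` in the rows `≥ x₁` and a cell `y` of the row `x₁` with `(y, 0) ∈ Λ`, the vertical floor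
mid-edge `t_y = {(y - e₁, 1), (y, 0)}` is a boundary mid-edge of `Λ` (its outer endpoint lies in
the row `x₁ - 1`). [folklore] -/
theorem floorEdge_mem_hexDomainBoundary {Λ : Finset HexVertex} {x y : Site 2}
    (hΛ : ∀ v ∈ Λ, x 1 ≤ v.1 1) (hy : y 1 = x 1) (hy0 : (y, (0 : Fin 2)) ∈ Λ) :
    s((y - Pi.single 1 1, 1), (y, 0)) ∈ hexDomainBoundary Λ :=
  ⟨(SimpleGraph.mem_edgeSet hexGraph).2 (adj_floorEdge y), _, _, rfl, hy0,
    floorEdge_down_not_mem hΛ hy⟩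

/-! ### The termwise bound -/

/-- **Termwise: half-plane arch tightness at span `n` bounds the far mass at every threshold
`R ≥ 2Kn` relative to the half-box of radius `R`.**  Let `hmain` be the body of HPAT for the
constant `K` and the ratio `η ≥ 0`.  For `Λ` in the rows `≥ x₁`, `B` the part of the rows `≥ x₁`
within distance `R` of `mid s_x`, and a floor cell `y` of the row `x₁` at floor distance
`|x₀ - y₀| = n ≥ 1` with `Kn ≤ R` and `2Kn ≤ R`:
`FarMass^R_Λ(s_x → t_y) ≤ η · Z_B(s_x → t_y)`.  Degenerate cases: if `(x, 0) ∉ Λ` or `(y, 0) ∉ Λ`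
there is no walk `s_x → t_y` in `Λ` and the left side vanishes; otherwise `s_x`, `t_y` are boundary
mid-edges of `Λ`, HPAT applies with the half-box `B' = {v ∈ B : |c_v - mid s_x| ≤ 2Kn}`, and
`FarMass^R ≤ FarMass^{Kn} ≤ η Z_{B'} ≤ η Z_B`. [cite: LawlerSchrammWerner2004SAW, §3.4 ("SAW satisfies restriction")] -/
theorem farArchMass_floor_le_of_halfPlaneArchTightness {η K : ℝ} (hη : 0 ≤ η)
    (hmain : ∀ (n : ℕ), 1 ≤ n → ∀ (Λ B : Finset HexVertex) (s t : Sym2 HexVertex),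
      s ∈ hexDomainBoundary Λ → t ∈ hexDomainBoundary Λ → s ≠ t →
      dist (hexMidpoint s) (hexMidpoint t) ≤ n →
      (hexMidpoint t).im = (hexMidpoint s).im →
      (∀ v ∈ Λ, (hexMidpoint s).im < (hexCenter v).im) →
      (∀ v : HexVertex, v ∈ B ↔ ((hexMidpoint s).im < (hexCenter v).im ∧
        dist (hexCenter v) (hexMidpoint s) ≤ 2 * K * n)) →
      (∑ γ : HexMidEdgeSAW Λ s t,
          if ∃ v ∈ γ.verts, K * n ≤ dist (hexCenter v) (hexMidpoint s)
          then hexCriticalFugacity ^ γ.length else 0) ≤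
        η * ∑ γ : HexMidEdgeSAW B s t, hexCriticalFugacity ^ γ.length)
    {x y : Site 2} {Λ B : Finset HexVertex} {R : ℝ} (hΛ : ∀ v ∈ Λ, x 1 ≤ v.1 1)
    (hB : ∀ v : HexVertex, v ∈ B ↔ (x 1 ≤ v.1 1 ∧
      dist (hexCenter v) (hexMidpoint s((x - Pi.single 1 1, 1), (x, 0))) ≤ R))
    (hy1 : y 1 = x 1) {n : ℕ} (hn : 1 ≤ n) (hxy : |((x 0 - y 0 : ℤ) : ℝ)| = n)
    (hKn : K * n ≤ R) (h2Kn : 2 * K * n ≤ R) :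
    (∑ γ : HexMidEdgeSAW Λ s((x - Pi.single 1 1, 1), (x, 0)) s((y - Pi.single 1 1, 1), (y, 0)),
        if ∃ v ∈ γ.verts, R ≤ dist (hexCenter v) (hexMidpoint s((x - Pi.single 1 1, 1), (x, 0)))
        then hexCriticalFugacity ^ γ.length else 0) ≤
      η * ∑ γ : HexMidEdgeSAW B s((x - Pi.single 1 1, 1), (x, 0)) s((y - Pi.single 1 1, 1), (y, 0)),
        hexCriticalFugacity ^ γ.length := by
  have hRHS : 0 ≤ η * ∑ γ : HexMidEdgeSAW B s((x - Pi.single 1 1, 1), (x, 0))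
      s((y - Pi.single 1 1, 1), (y, 0)), hexCriticalFugacity ^ γ.length :=
    mul_nonneg hη (archMass_nonneg _ _ _)
  -- degenerate cases: no walk at all
  by_cases hx0 : (x, (0 : Fin 2)) ∈ Λ
  swap
  · haveI := isEmpty_hexMidEdgeSAW_floorEdge_of_not_mem hΛ hx0 s((y - Pi.single 1 1, 1), (y, 0))
    rw [Fintype.sum_empty]
    exact hRHS
  have hyx : y ≠ x := by
    rintro rfl
    rw [sub_self, Int.cast_zero, abs_zero] at hxy
    have : n = 0 := by exact_mod_cast hxy.symm
    omega
  by_cases hy0 : (y, (0 : Fin 2)) ∈ Λ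
  swap
  · haveI := isEmpty_hexMidEdgeSAW_floorEdge_of_not_mem_right hΛ hy1 hyx hy0
    rw [Fintype.sum_empty]
    exact hRHS
  -- the inputs of half-plane arch tightness
  have hsbd : s((x - Pi.single 1 1, 1), (x, 0)) ∈ hexDomainBoundary Λ :=
    floorEdge_mem_hexDomainBoundary hΛ rfl hx0
  have htbd : s((y - Pi.single 1 1, 1), (y, 0)) ∈ hexDomainBoundary Λ :=
    floorEdge_mem_hexDomainBoundary hΛ hy1 hy0
  have hdist : dist (hexMidpoint s((x - Pi.single 1 1, 1), (x, 0)))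
      (hexMidpoint s((y - Pi.single 1 1, 1), (y, 0))) = n := by
    rw [dist_hexMidpoint_floorEdge x y hy1, hxy]
  have hst : s((x - Pi.single 1 1, (1 : Fin 2)), (x, (0 : Fin 2))) ≠
      s((y - Pi.single 1 1, 1), (y, 0)) := by
    intro h
    have h0 : (n : ℝ) = 0 := by rw [← hdist, h, dist_self]
    have : n = 0 := by exact_mod_cast h0
    omega
  have him : (hexMidpoint s((y - Pi.single 1 1, 1), (y, 0))).im =
      (hexMidpoint s((x - Pi.single 1 1, 1), (x, 0))).im := by
    rw [im_hexMidpoint_floorEdge, im_hexMidpoint_floorEdge, hy1]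
  have habove : ∀ v ∈ Λ, (hexMidpoint s((x - Pi.single 1 1, 1), (x, 0))).im < (hexCenter v).im :=
    forall_im_lt_of_rows hΛ
  -- the half-box of radius `2Kn`
  set B' := B.filter (fun v => dist (hexCenter v)
    (hexMidpoint s((x - Pi.single 1 1, 1), (x, 0))) ≤ 2 * K * n) with hB'
  have hB'B : B' ⊆ B := Finset.filter_subset _ _
  have hB'iff : ∀ v : HexVertex, v ∈ B' ↔
      ((hexMidpoint s((x - Pi.single 1 1, 1), (x, 0))).im < (hexCenter v).im ∧
        dist (hexCenter v) (hexMidpoint s((x - Pi.single 1 1, 1), (x, 0))) ≤ 2 * K * n) := by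
    rintro ⟨z, i⟩
    rw [hB', Finset.mem_filter, hB, im_hexMidpoint_lt_im_hexCenter_iff x z i]
    exact ⟨fun h => ⟨h.1.1, h.2⟩, fun h => ⟨⟨h.1, h.2.trans h2Kn⟩, h.2⟩⟩
  calc _ ≤ (∑ γ : HexMidEdgeSAW Λ s((x - Pi.single 1 1, 1), (x, 0)) s((y - Pi.single 1 1, 1), (y, 0)),
        if ∃ v ∈ γ.verts, K * n ≤ dist (hexCenter v) (hexMidpoint s((x - Pi.single 1 1, 1), (x, 0)))
        then hexCriticalFugacity ^ γ.length else 0) := farArchMass_anti Λ _ _ hKn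
    _ ≤ η * ∑ γ : HexMidEdgeSAW B' s((x - Pi.single 1 1, 1), (x, 0))
        s((y - Pi.single 1 1, 1), (y, 0)), hexCriticalFugacity ^ γ.length :=
        hmain n hn Λ B' _ _ hsbd htbd hst hdist.le him habove hB'iff
    _ ≤ _ := mul_le_mul_of_nonneg_left (archMass_mono hB'B _ _) hη

/-! ### The theorem -/

/-- **HALF-PLANE ARCH TIGHTNESS IMPLIES WINDOW-AVERAGED ARCH LOCALITY.**  The hypothesis is the
registered open stub `stub_halfPlaneArchTightness` verbatim (relative far-mass bound, pointwise in
the endpoint, uniform in the span); the conclusion is the window-averaged arch locality WAL consumed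
by the c5 bootstrap: for every `η > 0` there is `θb > 0` (namely `1/(2K)`, `K = K(η)` from HPAT)
such that for all `0 < θ₀ ≤ θb`, with `θ₁ := θ₀/2` and `R₀ := 1`, for every `R ≥ R₀`, every cell
`x`, every finite `Λ` in the rows `≥ x₁`, `B` the part of the rows `≥ x₁` within distance `R` of
`mid s_x`, and `S` the lattice window `{d : θ₁R ≤ d ≤ θ₀R}`:
`Σ_{d ∈ S} FarMass^R_Λ(s_x → t_d) ≤ η · Σ_{d ∈ S} Z_B(s_x → t_d)`.  Proof: termwise
(`farArchMass_floor_le_of_halfPlaneArchTightness`), since every `d ∈ S` is a positive integer with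
`2Kd ≤ 2Kθ₀R ≤ R`. [cite: LawlerSchrammWerner2004SAW, §3.4 ("SAW satisfies restriction")] -/
theorem windowArchLocality_of_halfPlaneArchTightness
    (H : ∀ ε : ℝ, 0 < ε → ∃ K : ℝ, 0 < K ∧ ∀ (n : ℕ), 1 ≤ n → ∀ (Λ B : Finset HexVertex)
      (s t : Sym2 HexVertex),
      s ∈ hexDomainBoundary Λ → t ∈ hexDomainBoundary Λ → s ≠ t →
      dist (hexMidpoint s) (hexMidpoint t) ≤ n →
      (hexMidpoint t).im = (hexMidpoint s).im →
      (∀ v ∈ Λ, (hexMidpoint s).im < (hexCenter v).im) →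
      (∀ v : HexVertex, v ∈ B ↔ ((hexMidpoint s).im < (hexCenter v).im ∧
        dist (hexCenter v) (hexMidpoint s) ≤ 2 * K * n)) →
      (∑ γ : HexMidEdgeSAW Λ s t,
          if ∃ v ∈ γ.verts, K * n ≤ dist (hexCenter v) (hexMidpoint s)
          then hexCriticalFugacity ^ γ.length else 0) ≤
        ε * ∑ γ : HexMidEdgeSAW B s t, hexCriticalFugacity ^ γ.length) :
    ∀ η : ℝ, 0 < η → ∃ θb : ℝ, 0 < θb ∧ ∀ θ₀ : ℝ, 0 < θ₀ → θ₀ ≤ θb →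
    ∃ θ₁ : ℝ, 0 < θ₁ ∧ θ₁ < θ₀ ∧ ∃ R₀ : ℝ, 0 < R₀ ∧ ∀ R : ℝ, R₀ ≤ R →
    ∀ (x : Site 2) (Λ B : Finset HexVertex) (S : Finset ℤ),
      (∀ v ∈ Λ, x 1 ≤ v.1 1) →
      (∀ v : HexVertex, v ∈ B ↔ (x 1 ≤ v.1 1 ∧
        dist (hexCenter v) (hexMidpoint s((x - Pi.single 1 1, 1), (x, 0))) ≤ R)) →
      (∀ d : ℤ, d ∈ S ↔ (θ₁ * R ≤ (d : ℝ) ∧ (d : ℝ) ≤ θ₀ * R)) →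
      ∑ d ∈ S, (∑ γ : HexMidEdgeSAW Λ s((x - Pi.single 1 1, 1), (x, 0))
          s((x + Pi.single 0 d - Pi.single 1 1, 1), (x + Pi.single 0 d, 0)),
        if ∃ v ∈ γ.verts, R ≤ dist (hexCenter v) (hexMidpoint s((x - Pi.single 1 1, 1), (x, 0)))
        then hexCriticalFugacity ^ γ.length else 0) ≤
      η * ∑ d ∈ S, ∑ γ : HexMidEdgeSAW B s((x - Pi.single 1 1, 1), (x, 0))
          s((x + Pi.single 0 d - Pi.single 1 1, 1), (x + Pi.single 0 d, 0)),
        hexCriticalFugacity ^ γ.length := by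
  intro η hη
  obtain ⟨K, hK, hmain⟩ := H η hη
  refine ⟨1 / (2 * K), by positivity, fun θ₀ hθ₀ hθ₀b => ⟨θ₀ / 2, by positivity, by linarith,
    1, one_pos, fun R hR x Λ B S hΛ hB hS => ?_⟩⟩
  rw [Finset.mul_sum]
  refine Finset.sum_le_sum fun d hd => ?_
  obtain ⟨hd1, hd2⟩ := (hS d).1 hd
  have hR0 : 0 < R := lt_of_lt_of_le one_pos hR
  have hdpos : (0 : ℝ) < d := lt_of_lt_of_le (by positivity) hd1
  have hd0 : (0 : ℤ) ≤ d := by exact_mod_cast hdpos.le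
  obtain ⟨n, rfl⟩ := Int.eq_ofNat_of_zero_le hd0
  push_cast at hdpos hd2
  have hn : 1 ≤ n := Nat.one_le_iff_ne_zero.2 (by rintro rfl; simp at hdpos)
  -- the window is below `θb R = R / (2K)`
  have hnR : (n : ℝ) ≤ R / (2 * K) := hd2.trans <| by
    calc θ₀ * R ≤ 1 / (2 * K) * R := mul_le_mul_of_nonneg_right hθ₀b hR0.le
      _ = R / (2 * K) := by ring
  have h2Kn : 2 * K * n ≤ R := by
    calc 2 * K * n ≤ 2 * K * (R / (2 * K)) := mul_le_mul_of_nonneg_left hnR (by positivity)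
      _ = R := by field_simp
  have hKn : K * n ≤ R := by nlinarith [mul_nonneg hK.le n.cast_nonneg]
  have hxy : |((x 0 - (x + Pi.single 0 (n : ℤ) : Site 2) 0 : ℤ) : ℝ)| = n := by
    rw [show x 0 - (x + Pi.single 0 (n : ℤ) : Site 2) 0 = -(n : ℤ) by
      have := offsetCell_sub x (n : ℤ); omega]
    simp
  exact farArchMass_floor_le_of_halfPlaneArchTightness hη.le hmain hΛ hB
    (offsetCell_apply_one x n) hn hxy hKn h2Kn

/-- **Registered sub-goal `stub_windowArchLocality_of_archTightness`** (crux item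
stmt-CriticalPhenomena-0808, line `root-locality-replaces-loewner`, c5 reshape of the lever): the
registered open stub `stub_halfPlaneArchTightness` (HPAT) implies the window-averaged arch locality
`stub_windowArchLocality` (WAL), termwise over the lattice floor window
(`windowArchLocality_of_halfPlaneArchTightness`). [cite: LawlerSchrammWerner2004SAW, §3.4 ("SAW satisfies restriction")] -/
theorem stub_windowArchLocality_of_archTightness : (∀ ε : ℝ, 0 < ε → ∃ K : ℝ, 0 < K ∧ ∀ (n : ℕ), 1 ≤ n → ∀ (Λ B : Finset Literature.Probability.LatticeModels.HexVertex) (s t : Sym2 Literature.Probability.LatticeModels.HexVertex), s ∈ Literature.Probability.RandomPlanarGeometry.SAW.hexDomainBoundary Λ → t ∈ Literature.Probability.RandomPlanarGeometry.SAW.hexDomainBoundary Λ → s ≠ t → dist (Literature.Probability.RandomPlanarGeometry.SAW.hexMidpoint s) (Literature.Probability.RandomPlanarGeometry.SAW.hexMidpoint t) ≤ n → (Literature.Probability.RandomPlanarGeometry.SAW.hexMidpoint t).im = (Literature.Probability.RandomPlanarGeometry.SAW.hexMidpoint s).im → (∀ v ∈ Λ, (Literature.Probability.RandomPlanarGeometry.SAW.hexMidpoint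 s).im < (Literature.Probability.LatticeModels.hexCenter v).im) → (∀ v : Literature.Probability.LatticeModels.HexVertex, v ∈ B ↔ ((Literature.Probability.RandomPlanarGeometry.SAW.hexMidpoint s).im < (Literature.Probability.LatticeModels.hexCenter v).im ∧ dist (Literature.Probability.LatticeModels.hexCenter v) (Literature.Probability.RandomPlanarGeometry.SAW.hexMidpoint s) ≤ 2 * K * n)) → (∑ γ : Literature.Probability.RandomPlanarGeometry.SAW.HexMidEdgeSAW Λ s t, if ∃ v ∈ γ.verts, K * n ≤ dist (Literature.Probability.LatticeModels.hexCenter v) (Literature.Probability.RandomPlanarGeometry.SAW.hexMidpoint s) then Literature.Probability.RandomPlanarGeometry.SAW.hexCriticalFugacity ^ γ.length else 0) ≤ ε * ∑ γ : Literature.Probability.RandomPlanarGeometry.SAW.HexMidEdgeSAW B s t, Literature.Probability.RandomPlanarGeometry.SAW.hexCriticalFugacity ^ γ.length) → (∀ η : ℝ, 0 < η → ∃ θb : ℝ, 0 < θb ∧ ∀ θ₀ : ℝ, 0 < θ₀ → θ₀ ≤ θb → ∃ θ₁ : ℝ, 0 < θ₁ ∧ θ₁ < θ₀ ∧ ∃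 R₀ : ℝ, 0 < R₀ ∧ ∀ R : ℝ, R₀ ≤ R → ∀ (x : Literature.Probability.LatticeModels.Site 2) (Λ B : Finset Literature.Probability.LatticeModels.HexVertex) (S : Finset ℤ), (∀ v ∈ Λ, x 1 ≤ v.1 1) → (∀ v : Literature.Probability.LatticeModels.HexVertex, v ∈ B ↔ (x 1 ≤ v.1 1 ∧ dist (Literature.Probability.LatticeModels.hexCenter v) (Literature.Probability.RandomPlanarGeometry.SAW.hexMidpoint s((x - Pi.single 1 1, 1), (x, 0))) ≤ R)) → (∀ d : ℤ, d ∈ S ↔ (θ₁ * R ≤ (d : ℝ) ∧ (d : ℝ) ≤ θ₀ * R)) → ∑ d ∈ S, (∑ γ : Literature.Probability.RandomPlanarGeometry.SAW.HexMidEdgeSAW Λ s((x - Pi.single 1 1, 1), (x, 0)) s((x + Pi.single 0 d - Pi.single 1 1, 1), (x + Pi.single 0 d, 0)), if ∃ v ∈ γ.verts, R ≤ dist (Literature.Probability.LatticeModels.hexCenter v) (Literature.Probability.RandomPlanarGeometry.SAW.hexMidpoint s((x - Pi.single 1 1, 1), (x, 0))) then Literature.Probability.RandomPlanarGeometry.SAW.hexCriticalFugacity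 ^ γ.length else 0) ≤ η * ∑ d ∈ S, ∑ γ : Literature.Probability.RandomPlanarGeometry.SAW.HexMidEdgeSAW B s((x - Pi.single 1 1, 1), (x, 0)) s((x + Pi.single 0 d - Pi.single 1 1, 1), (x + Pi.single 0 d, 0)), Literature.Probability.RandomPlanarGeometry.SAW.hexCriticalFugacity ^ γ.length) :=
  windowArchLocality_of_halfPlaneArchTightness

end Summit.CriticalPhenomena.SAWScalingLimit.Theorems.HexConjecture.RootLocality

end
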